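import Summits.QuantumFields.YangMills.Theorems.BalabanUVNodesRateReadingOfRecord13
import Summits.QuantumFields.YangMills.Theorems.BalabanUVNodesN22EdgeAtW1Reading12

/-!
# BalabanUVNodes ∕ node N22 ⟸ node N18 AT A W1-PINNED READING OF THE STAGE-13 HOMES `RRec₁₃ 𝔯` ∕ `RRec₁₃On 𝔯 Rg` and AT THE STAGE-13 READING OF RECORD — the edge
# N18 → N22 BY NAME at `Record13`, in the STRIP currency (dag-n22-c's θ-form `n22At_u3OfRecord₁₂_w1Reading_of_n18Below_stripBound`) and in the ANALYTIC sup-letter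
# currency (A) (the lineage's θ-form `n22At_u3OfRecord₁₂_w1_of_n18Below_analytic`), both read at Stage 13 through layer B's `rfl` bridge `u3OfRecord₁₃_eq_u3OfRecord₁₂`

Track A of `YM-PLAN.md` (cell `pub-ymgap`, HUMAN RULING D-0062), R134 seat `pub-ymgap-dag-n22-e` (s2 «`FadingMemory` by name from a modulus + knit at the record»), gen 5,
module 7″ = the Stage-13 edition of the lineage's module 7 `…N22EdgeAtW1Reading12.lean` (p478043), GENERALISED (like 9″c) from the one named reading
`ofAssignment (W1.assignment₁₂ 𝔇) ne1` to EVERY Stage-13 reading with the W1 pin `hpin : ∀ F θ hP g₀ os, (𝔯.lit F θ hP g₀ os).u3 = (w1 F θ).u3Objects θ.γ`, and instantiated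
at the reading of record `readingOfRecord₁₃ w1 ℓ₃ ne2 ne1` (module 6″, `hpin := rfl`).  Director-ym LINE №125 «RECORD 13» ∕ №133 ∕ №135 (route rev 17 READY, K3‴
`SpineGivenEndpointR13` = stmt-QuantumFields-19912); dag-lead WORDS-133 ∕ 134 ∕ 135.  THEOREMS ONLY; every proof is one application BY NAME of the Stage-12 θ-forms (dag-n22-c
`…N22W1StripN18Edge` p476424 §1–§2; this lineage's module 7 §2) at the parent tuple `θ.toStage12Params` — the Stage-13 bundle IS the Stage-12 bundle of the parent tuple
(`u3OfRecord₁₃_eq_u3OfRecord₁₂`, `rfl`) — composed with the Stage-13 homes' θ-forms (`s_N18 ∕ s_N22_rRec₁₃(On)_iff`, 9″c's `s_N22_rRec₁₃_w1_iff`).  Restate-immune (no Theses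
import); COUNT-NEUTRAL; `--supports` K3‴ as a helper.

WHAT IS KERNEL-CHECKED ([folklore]; 0 `def`, 0 `sorry`).
* §1 `s_N22_rRec₁₃On_w1_of_s_N18_stripBound` — REGIME ∕ TUPLE HOME × STRIP: `S_N18 (RRec₁₃On 𝔯 Rg)` + per admissible tuple in `Rg` dag-n22-c's coherence ∕ junk binder `hcoh`
  for `w1 F θ`, the inputs' numerals and STRIP-(1.18) per run length ⟹ `S_N22 (RRec₁₃On 𝔯 Rg)`.
* §2 `n22At_u3OfRecord₁₃_w1_of_n18Below_analytic` — θ-form at ONE Stage-13 tuple, analytic currency: N18 below `k` + (C1)(C2)(J) + (A) at `k` + numerals ⟹ `N22At` at `k`.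
* §3 `s_N22_rRec₁₃_w1_of_s_N18_analytic` (canonical home × (A)) · `s_N22_rRec₁₃On_w1_of_s_N18_analytic` (regime home × (A)).
* §4 AT THE READING OF RECORD (6″): `s_N22_readingOfRecord₁₃_of_s_N18_analytic` · `s_N22_readingOfRecord₁₃On_of_s_N18_analytic` · `s_N22_readingOfRecord₁₃On_of_s_N18_stripBound`.

HONEST FRAMING.  The edge TRANSFERS node N18's stub (a hypothesis at the same reading; dag-n18-d's lane) and dag-n22-c's displayed regularity inputs (STRIP-(1.18) per run length,
or the analytic sup letter (A); coherence (C1)(C2), junk-freeness (J); numerals) into node N22's stub; none of these has a producer at a reading of record today; W1's towers are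
residual DATA; nothing of Bałaban's is asserted or instantiated — NE5 ∕ NE9 NOT PRINTED for d = 4 and NOT PROVED; no inhabitant of `IsDatumOfRecord₁₃C` claimed (K0‴
`Record13Inhabited`, stmt-QuantumFields-19909, OPEN); N22 NOT discharged; counts UNMOVED (typed 28∕28 · discharged 5∕27, A 5∕28); one finite four-torus programme at fixed `ε` —
NOT ℝ⁴, NOT infinite volume, NOT OS, NOT a mass gap, NOT Clay.  No decl below carries a cite tag.
-/

noncomputable section

namespace YMDAG.N22

open Set Metric
open scoped BigOperators
open Literature.MathematicalPhysics.QuantumFieldTheory.Balaban1983to89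
open Literature.MathematicalPhysics.QuantumFieldTheory.Balaban1983to89.T4Continuum
open Literature.MathematicalPhysics.QuantumFieldTheory.Balaban1983to89.T4OutputRate
open Literature.MathematicalPhysics.QuantumFieldTheory.Balaban1983to89.TreeLengthTorus (torusTreeLen)
open Literature.MathematicalPhysics.QuantumFieldTheory.Balaban1983to89.Node00 (Stage13Params IsDatumOfRecord₁₃C NE2Objects₁₁ NE3Letters₁₁ MatA)
open Literature.MathematicalPhysics.QuantumFieldTheory.Balaban1983to89.Node00.Sect2 (domSys CPair)
open Literature.MathematicalPhysics.QuantumFieldTheory.Balaban1983to89.Node00.W1 (ReadingData termC)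
open YMDAG.UVSplit
open YMDAG.N22.W1 (oscFading_w1Reading_of_n18At_below n22At_u3OfRecord₁₂_w1Reading_of_n18Below_stripBound)

variable {N : ℕ} [NeZero N]

/-! ## §1 The edge at the regime ∕ tuple home `RRec₁₃On 𝔯 Rg`, strip currency, for a W1-pinned reading -/

section RegimeStrip

variable (𝔯 : RateReading₁₃ N) (w1 : (F : T4Family) → (θ : Stage13Params F N) → ReadingData F (MatA N) θ.τ9.M) (Rg : (F : T4Family) → Stage13Params F N → Prop)

open Classical in
/-- **THE EDGE N18 → N22 AT A W1-PINNED STAGE-13 READING, REGIME ∕ TUPLE HOME, STRIP CURRENCY.**  For ANY reading `𝔯` with `(𝔯.lit F θ hP g₀ os).u3 = (w1 F θ).u3Objects θ.γ`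
and ANY regime `Rg`: `S_N18 (RRec₁₃On 𝔯 Rg)` together with, per admissible Stage-13 tuple with provisos IN `Rg`, dag-n22-c's coherence ∕ junk binder `hcoh` for `w1 F θ`, the
inputs' numerals and STRIP-(1.18) per run length (their `hstrip` verbatim) ⟹ `S_N22 (RRec₁₃On 𝔯 Rg)` — their θ-form at the parent tuple `θ.toStage12Params`, read through 5″'s
guarded θ-forms.  Every hypothesis is asked ONLY in the regime. [folklore] -/
theorem s_N22_rRec₁₃On_w1_of_s_N18_stripBound
    (hpin : ∀ (F : T4Family) (θ : Stage13Params F N) (hP : θ.Provisos₁₃ F N) (g₀ : ℕ → ℝ) (os : List (ULoop F)), (𝔯.lit F θ hP g₀ os).u3 = (w1 F θ).u3Objects θ.γ)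
    (h18 : S_N18 (RRec₁₃On 𝔯 Rg))
    (hcoh : ∀ (F : T4Family) (θ : Stage13Params F N), θ.Provisos₁₃ F N → Rg F θ → θ.Admissible F N →
      (∀ (k : ℕ) (X₁ : Node00.W1.Dom (F.P k) θ.τ9.M), (((w1 F θ).pairing k).pair X₁).1 = X₁.1 + 1) ∧
      (∀ (k : ℕ) (X₁ : Node00.W1.Dom (F.P k) θ.τ9.M),
        (domSys (F.P (k + 1)) θ.τ9.M (((w1 F θ).pairing k).pair X₁).1).dj (((w1 F θ).pairing k).pair X₁).2 = (domSys (F.P k) θ.τ9.M X₁.1).dj X₁.2) ∧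
      (∀ (k : ℕ) (X : Node00.W1.Dom (F.P (k + 1)) θ.τ9.M), 1 ≤ X.1 → ∃ X₁ : Node00.W1.Dom (F.P k) θ.τ9.M, ((w1 F θ).pairing k).pair X₁ = X) ∧
      (∀ (k : ℕ) (U : ((w1 F θ).pairing (k + 1)).BgA), ∃ U₁ : ((w1 F θ).pairing k).BgB, ((w1 F θ).pairing k).embB U₁ = ((w1 F θ).pairing (k + 1)).embA U) ∧
      (∀ (k : ℕ) (g : ℕ → ℝ) (U : ((w1 F θ).pairing k).BgA) (X : Node00.W1.Dom (F.P k) θ.τ9.M), k < X.1 → ((w1 F θ).pairing k).EA ((w1 F θ).S k) g U X = 0))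
    (hnum : ∀ (F : T4Family) (θ : Stage13Params F N), θ.Provisos₁₃ F N → Rg F θ → θ.Admissible F N →
      0 < (w1 F θ).li.C₀ ∧ 0 < (w1 F θ).li.θ₅ ∧ (w1 F θ).li.θ₅ < 1 ∧ 0 ≤ (w1 F θ).li.C₅ ∧
        2 * (w1 F θ).li.C₅ / (1 - (w1 F θ).li.θ₅) ≤ (w1 F θ).li.C₀ ∧ 0 < (w1 F θ).li.A ∧ (w1 F θ).li.θ₅ ≤ (w1 F θ).li.μ ∧
        (w1 F θ).li.C₀ ≤ 2 * (w1 F θ).li.A ∧ 0 < (w1 F θ).li.r ∧ 0 < (w1 F θ).li.s ∧ (w1 F θ).li.s < 1 ∧ 1 ≤ (w1 F θ).li.μ)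
    (hstrip : ∀ (F : T4Family) (θ : Stage13Params F N), θ.Provisos₁₃ F N → Rg F θ → θ.Admissible F N → ∀ (k : ℕ),
      ∃ sp : (j : ℕ) → (domSys (F.P k) θ.τ9.M j).Dom → Set (CPair (F.P k) (MatA N)),
        (∀ (j : ℕ) (U : ((w1 F θ).pairing k).BgA) (Y : (domSys (F.P k) θ.τ9.M j).Dom), ((w1 F θ).pairing k).embA U ∈ sp j Y) ∧
        (∀ (j : ℕ) (g : ℕ → ℝ), g ∈ Window θ.γ → ∀ (i : ℕ) (Y : (domSys (F.P k) θ.τ9.M j).Dom) (ψ : CPair (F.P k) (MatA N)), ψ ∈ sp j Y →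
          ∃ (Ec : ℂ → ℂ) (O : Set ℂ), IsOpen O ∧ (∀ t ∈ Ioc (0 : ℝ) θ.γ, closedBall (t : ℂ) (w1 F θ).li.r ⊆ O) ∧ DifferentiableOn ℂ Ec O ∧
            (∀ z ∈ O, ‖Ec z‖ ≤ (w1 F θ).li.A * Real.exp (-((w1 F θ).li.κ * torusTreeLen Y.1))) ∧
            (∀ t ∈ Ioc (0 : ℝ) θ.γ, Ec t = termC ((w1 F θ).S k) j Y (Function.update g i t) ψ))) :
    S_N22 (RRec₁₃On 𝔯 Rg) := by
  rw [s_N22_rRec₁₃On_iff]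
  rw [s_N18_rRec₁₃On_iff] at h18
  intro F θ hP hRg hθ g₀ os k
  obtain ⟨hfst, hdj, hsurj, hbg, hjunk⟩ := hcoh F θ hP hRg hθ
  obtain ⟨hC₀, hθ5, hθ1, hC5, hC₀', hA, hθμ, hCM, hr, hs0, hs1, hμ1⟩ := hnum F θ hP hRg hθ
  obtain ⟨sp, hsp, hall⟩ := hstrip F θ hP hRg hθ k
  have h18' : ∀ k' : ℕ, k' < k → N18At (u3OfRecord₁₂ θ.toStage12Params ((w1 F θ).u3Objects θ.γ) k') := fun k' _ => by
    rw [← u3OfRecord₁₃_eq_u3OfRecord₁₂, ← hpin F θ hP g₀ os]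
    exact h18 F θ hP hRg hθ g₀ os k'
  rw [hpin F θ hP g₀ os, u3OfRecord₁₃_eq_u3OfRecord₁₂]
  exact n22At_u3OfRecord₁₂_w1Reading_of_n18Below_stripBound θ.toStage12Params (w1 F θ) k sp hsp hall hfst hdj hsurj hbg hjunk h18' hC5 hθ1 hC₀' hC₀ hθ5 hA hμ1
    hθμ hCM hr hθ.toStage9.gamma_pos hs0 hs1

end RegimeStrip

/-! ## §2 The edge in the analytic sup-letter currency (A), θ-form at one Stage-13 tuple -/

section ThetaAnalytic

variable {F : T4Family} (θ : Stage13Params F N) (D : ReadingData F (MatA N) θ.τ9.M) (k : ℕ)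

/-- **N18 BELOW `k` ⇒ N22 AT `k`, AT ONE STAGE-13 TUPLE, ANALYTIC SUP-LETTER CURRENCY** — module 7 §2's θ-form at the parent tuple `θ.toStage12Params` (`u3OfRecord₁₃_eq_u3OfRecord₁₂`,
`rfl`): `N18At` at the bundles `u3OfRecord₁₃ θ (D.u3Objects θ.γ) k′`, `k′ < k`; dag-n22-c's coherence (C1)(C2) and junk-freeness (J) of `D`; the analytic letter (A) at run
length `k` (9″c's `hA` literal); the numerals; `0 < θ.γ` ⟹ `N22At (u3OfRecord₁₃ θ (D.u3Objects θ.γ) k)`. [folklore] -/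
theorem n22At_u3OfRecord₁₃_w1_of_n18Below_analytic
    (h18 : ∀ k' : ℕ, k' < k → N18At (u3OfRecord₁₃ θ (D.u3Objects θ.γ) k'))
    (hfst : ∀ (k : ℕ) (X₁ : Node00.W1.Dom (F.P k) θ.τ9.M), ((D.pairing k).pair X₁).1 = X₁.1 + 1)
    (hdj : ∀ (k : ℕ) (X₁ : Node00.W1.Dom (F.P k) θ.τ9.M),
      (domSys (F.P (k + 1)) θ.τ9.M ((D.pairing k).pair X₁).1).dj ((D.pairing k).pair X₁).2 = (domSys (F.P k) θ.τ9.M X₁.1).dj X₁.2)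
    (hsurj : ∀ (k : ℕ) (X : Node00.W1.Dom (F.P (k + 1)) θ.τ9.M), 1 ≤ X.1 → ∃ X₁ : Node00.W1.Dom (F.P k) θ.τ9.M, (D.pairing k).pair X₁ = X)
    (hbg : ∀ (k : ℕ) (U : (D.pairing (k + 1)).BgA), ∃ U₁ : (D.pairing k).BgB, (D.pairing k).embB U₁ = (D.pairing (k + 1)).embA U)
    (hjunk : ∀ (k : ℕ) (g : ℕ → ℝ) (U : (D.pairing k).BgA) (X : Node00.W1.Dom (F.P k) θ.τ9.M), k < X.1 → (D.pairing k).EA (D.S k) g U X = 0)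
    (hA : ∀ g ∈ Window θ.γ, ∀ (U : ((D.u3Objects θ.γ).levelCarriers k).BgA) (X : ((D.u3Objects θ.γ).levelCarriers k).Dom) (i : ℕ),
      i < ((D.u3Objects θ.γ).levelCarriers k).scale X → ∃ (Fz : ℂ → ℂ) (Dset : Set ℂ), DifferentiableOn ℂ Fz Dset ∧
        (∀ z ∈ Dset, ‖Fz z‖ ≤ D.li.A * D.li.μ ^ (((D.u3Objects θ.γ).levelCarriers k).scale X - 1 - i) *
          Real.exp (-((D.u3Objects θ.γ).κ * ((D.u3Objects θ.γ).levelCarriers k).d X))) ∧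
        (∀ t ∈ Ioc (0 : ℝ) θ.γ, closedBall (t : ℂ) D.li.r ⊆ Dset) ∧
        (∀ t ∈ Ioc (0 : ℝ) θ.γ, Fz t = ((D.u3Objects θ.γ).EA k (Function.update g i t) U X : ℂ)))
    (hnum : 0 < D.li.C₀ ∧ 0 < D.li.θ₅ ∧ D.li.θ₅ < 1 ∧ 0 ≤ D.li.C₅ ∧ 2 * D.li.C₅ / (1 - D.li.θ₅) ≤ D.li.C₀ ∧ 0 < D.li.A ∧ D.li.θ₅ ≤ D.li.μ ∧
      D.li.C₀ ≤ 2 * D.li.A ∧ 0 < D.li.r ∧ 0 < D.li.s ∧ D.li.s < 1)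
    (hγ : 0 < θ.γ) :
    N22At (u3OfRecord₁₃ θ (D.u3Objects θ.γ) k) := by
  rw [u3OfRecord₁₃_eq_u3OfRecord₁₂]
  exact n22At_u3OfRecord₁₂_w1_of_n18Below_analytic θ.toStage12Params D k (fun k' hk' => by rw [← u3OfRecord₁₃_eq_u3OfRecord₁₂]; exact h18 k' hk')
    hfst hdj hsurj hbg hjunk hA hnum hγ

end ThetaAnalytic

/-! ## §3 The edge at the Stage-13 homes, analytic currency, for a W1-pinned reading -/

section StubAnalytic

variable (𝔯 : RateReading₁₃ N) (w1 : (F : T4Family) → (θ : Stage13Params F N) → ReadingData F (MatA N) θ.τ9.M)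

/-- **THE EDGE N18 → N22 AT A W1-PINNED STAGE-13 READING, CANONICAL HOME, ANALYTIC CURRENCY.**  `S_N18 (RRec₁₃ 𝔯)` and — per admissible Stage-13 tuple with provisos —
dag-n22-c's `hcoh` for `w1 F θ`, the analytic letter (A) at every run length (9″c's `hA` verbatim) and the numerals ⟹ `S_N22 (RRec₁₃ 𝔯)`: at each datum key all run lengths are
bundles of record at the canonical parameter (layer B's `s_N18_rRec₁₃_iff` ∕ 9″c's `s_N22_rRec₁₃_w1_iff`), so §2 applies level by level.  This is 9″c's
`s_N22_rRec₁₃_w1_of_oscAnalytic` with its (O) hypothesis REPLACED by `S_N18` + `hcoh`. [folklore] -/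
theorem s_N22_rRec₁₃_w1_of_s_N18_analytic
    (hpin : ∀ (F : T4Family) (θ : Stage13Params F N) (hP : θ.Provisos₁₃ F N) (g₀ : ℕ → ℝ) (os : List (ULoop F)), (𝔯.lit F θ hP g₀ os).u3 = (w1 F θ).u3Objects θ.γ)
    (h18 : S_N18 (RRec₁₃ 𝔯))
    (hcoh : ∀ (F : T4Family) (θ : Stage13Params F N), θ.Provisos₁₃ F N → θ.Admissible F N →
      (∀ (k : ℕ) (X₁ : Node00.W1.Dom (F.P k) θ.τ9.M), (((w1 F θ).pairing k).pair X₁).1 = X₁.1 + 1) ∧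
      (∀ (k : ℕ) (X₁ : Node00.W1.Dom (F.P k) θ.τ9.M),
        (domSys (F.P (k + 1)) θ.τ9.M (((w1 F θ).pairing k).pair X₁).1).dj (((w1 F θ).pairing k).pair X₁).2 = (domSys (F.P k) θ.τ9.M X₁.1).dj X₁.2) ∧
      (∀ (k : ℕ) (X : Node00.W1.Dom (F.P (k + 1)) θ.τ9.M), 1 ≤ X.1 → ∃ X₁ : Node00.W1.Dom (F.P k) θ.τ9.M, ((w1 F θ).pairing k).pair X₁ = X) ∧
      (∀ (k : ℕ) (U : ((w1 F θ).pairing (k + 1)).BgA), ∃ U₁ : ((w1 F θ).pairing k).BgB, ((w1 F θ).pairing k).embB U₁ = ((w1 F θ).pairing (k + 1)).embA U) ∧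
      (∀ (k : ℕ) (g : ℕ → ℝ) (U : ((w1 F θ).pairing k).BgA) (X : Node00.W1.Dom (F.P k) θ.τ9.M), k < X.1 → ((w1 F θ).pairing k).EA ((w1 F θ).S k) g U X = 0))
    (hA : ∀ (F : T4Family) (θ : Stage13Params F N), θ.Provisos₁₃ F N → θ.Admissible F N → ∀ (k : ℕ),
      ∀ g ∈ Window θ.γ, ∀ (U : (((w1 F θ).u3Objects θ.γ).levelCarriers k).BgA) (X : (((w1 F θ).u3Objects θ.γ).levelCarriers k).Dom) (i : ℕ),
        i < (((w1 F θ).u3Objects θ.γ).levelCarriers k).scale X → ∃ (Fz : ℂ → ℂ) (Dset : Set ℂ), DifferentiableOn ℂ Fz Dset ∧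
          (∀ z ∈ Dset, ‖Fz z‖ ≤ (w1 F θ).li.A * (w1 F θ).li.μ ^ ((((w1 F θ).u3Objects θ.γ).levelCarriers k).scale X - 1 - i) *
            Real.exp (-(((w1 F θ).u3Objects θ.γ).κ * (((w1 F θ).u3Objects θ.γ).levelCarriers k).d X))) ∧
          (∀ t ∈ Ioc (0 : ℝ) θ.γ, closedBall (t : ℂ) (w1 F θ).li.r ⊆ Dset) ∧
          (∀ t ∈ Ioc (0 : ℝ) θ.γ, Fz t = (((w1 F θ).u3Objects θ.γ).EA k (Function.update g i t) U X : ℂ)))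
    (hnum : ∀ (F : T4Family) (θ : Stage13Params F N), θ.Provisos₁₃ F N → θ.Admissible F N →
      0 < (w1 F θ).li.C₀ ∧ 0 < (w1 F θ).li.θ₅ ∧ (w1 F θ).li.θ₅ < 1 ∧ 0 ≤ (w1 F θ).li.C₅ ∧
        2 * (w1 F θ).li.C₅ / (1 - (w1 F θ).li.θ₅) ≤ (w1 F θ).li.C₀ ∧ 0 < (w1 F θ).li.A ∧ (w1 F θ).li.θ₅ ≤ (w1 F θ).li.μ ∧
        (w1 F θ).li.C₀ ≤ 2 * (w1 F θ).li.A ∧ 0 < (w1 F θ).li.r ∧ 0 < (w1 F θ).li.s ∧ (w1 F θ).li.s < 1) :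
    S_N22 (RRec₁₃ 𝔯) := by
  rw [s_N22_rRec₁₃_w1_iff 𝔯 w1 hpin]
  rw [s_N18_rRec₁₃_iff] at h18
  intro F D h k
  obtain ⟨hfst, hdj, hsurj, hbg, hjunk⟩ := hcoh F h.params h.provisos h.admissible
  refine n22At_u3OfRecord₁₃_w1_of_n18Below_analytic h.params (w1 F h.params) k (fun k' _ => ?_) hfst hdj hsurj hbg hjunk
    (hA F h.params h.provisos h.admissible k) (hnum F h.params h.provisos h.admissible) h.gamma_pos
  rw [← hpin F h.params h.provisos (fun _ => 0) []]
  exact h18 F D h (fun _ => 0) [] k'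

/-- **THE SAME AT THE REGIME ∕ TUPLE HOME** `RRec₁₃On 𝔯 Rg` (any regime `Rg`; 5″'s guarded θ-forms; the hypotheses asked only of the admissible tuples with provisos in the
regime). [folklore] -/
theorem s_N22_rRec₁₃On_w1_of_s_N18_analytic (Rg : (F : T4Family) → Stage13Params F N → Prop)
    (hpin : ∀ (F : T4Family) (θ : Stage13Params F N) (hP : θ.Provisos₁₃ F N) (g₀ : ℕ → ℝ) (os : List (ULoop F)), (𝔯.lit F θ hP g₀ os).u3 = (w1 F θ).u3Objects θ.γ)
    (h18 : S_N18 (RRec₁₃On 𝔯 Rg))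
    (hcoh : ∀ (F : T4Family) (θ : Stage13Params F N), θ.Provisos₁₃ F N → Rg F θ → θ.Admissible F N →
      (∀ (k : ℕ) (X₁ : Node00.W1.Dom (F.P k) θ.τ9.M), (((w1 F θ).pairing k).pair X₁).1 = X₁.1 + 1) ∧
      (∀ (k : ℕ) (X₁ : Node00.W1.Dom (F.P k) θ.τ9.M),
        (domSys (F.P (k + 1)) θ.τ9.M (((w1 F θ).pairing k).pair X₁).1).dj (((w1 F θ).pairing k).pair X₁).2 = (domSys (F.P k) θ.τ9.M X₁.1).dj X₁.2) ∧
      (∀ (k : ℕ) (X : Node00.W1.Dom (F.P (k + 1)) θ.τ9.M), 1 ≤ X.1 → ∃ X₁ : Node00.W1.Dom (F.P k) θ.τ9.M, ((w1 F θ).pairing k).pair X₁ = X) ∧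
      (∀ (k : ℕ) (U : ((w1 F θ).pairing (k + 1)).BgA), ∃ U₁ : ((w1 F θ).pairing k).BgB, ((w1 F θ).pairing k).embB U₁ = ((w1 F θ).pairing (k + 1)).embA U) ∧
      (∀ (k : ℕ) (g : ℕ → ℝ) (U : ((w1 F θ).pairing k).BgA) (X : Node00.W1.Dom (F.P k) θ.τ9.M), k < X.1 → ((w1 F θ).pairing k).EA ((w1 F θ).S k) g U X = 0))
    (hA : ∀ (F : T4Family) (θ : Stage13Params F N), θ.Provisos₁₃ F N → Rg F θ → θ.Admissible F N → ∀ (k : ℕ),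
      ∀ g ∈ Window θ.γ, ∀ (U : (((w1 F θ).u3Objects θ.γ).levelCarriers k).BgA) (X : (((w1 F θ).u3Objects θ.γ).levelCarriers k).Dom) (i : ℕ),
        i < (((w1 F θ).u3Objects θ.γ).levelCarriers k).scale X → ∃ (Fz : ℂ → ℂ) (Dset : Set ℂ), DifferentiableOn ℂ Fz Dset ∧
          (∀ z ∈ Dset, ‖Fz z‖ ≤ (w1 F θ).li.A * (w1 F θ).li.μ ^ ((((w1 F θ).u3Objects θ.γ).levelCarriers k).scale X - 1 - i) *
            Real.exp (-(((w1 F θ).u3Objects θ.γ).κ * (((w1 F θ).u3Objects θ.γ).levelCarriers k).d X))) ∧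
          (∀ t ∈ Ioc (0 : ℝ) θ.γ, closedBall (t : ℂ) (w1 F θ).li.r ⊆ Dset) ∧
          (∀ t ∈ Ioc (0 : ℝ) θ.γ, Fz t = (((w1 F θ).u3Objects θ.γ).EA k (Function.update g i t) U X : ℂ)))
    (hnum : ∀ (F : T4Family) (θ : Stage13Params F N), θ.Provisos₁₃ F N → Rg F θ → θ.Admissible F N →
      0 < (w1 F θ).li.C₀ ∧ 0 < (w1 F θ).li.θ₅ ∧ (w1 F θ).li.θ₅ < 1 ∧ 0 ≤ (w1 F θ).li.C₅ ∧
        2 * (w1 F θ).li.C₅ / (1 - (w1 F θ).li.θ₅) ≤ (w1 F θ).li.C₀ ∧ 0 < (w1 F θ).li.A ∧ (w1 F θ).li.θ₅ ≤ (w1 F θ).li.μ ∧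
        (w1 F θ).li.C₀ ≤ 2 * (w1 F θ).li.A ∧ 0 < (w1 F θ).li.r ∧ 0 < (w1 F θ).li.s ∧ (w1 F θ).li.s < 1) :
    S_N22 (RRec₁₃On 𝔯 Rg) := by
  rw [s_N22_rRec₁₃On_iff]
  rw [s_N18_rRec₁₃On_iff] at h18
  intro F θ hP hRg hθ g₀ os k
  obtain ⟨hfst, hdj, hsurj, hbg, hjunk⟩ := hcoh F θ hP hRg hθ
  rw [hpin F θ hP g₀ os]
  refine n22At_u3OfRecord₁₃_w1_of_n18Below_analytic θ (w1 F θ) k (fun k' _ => ?_) hfst hdj hsurj hbg hjunk (hA F θ hP hRg hθ k) (hnum F θ hP hRg hθ)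
    hθ.toStage9.gamma_pos
  rw [← hpin F θ hP g₀ os]
  exact h18 F θ hP hRg hθ g₀ os k'

end StubAnalytic

/-! ## §4 The edge at the Stage-13 reading of record (module 6″), both homes, both currencies -/

section ReadingOfRecord

variable (w1 : (F : T4Family) → (θ : Stage13Params F N) → ReadingData F (MatA N) θ.τ9.M) (ℓ₃ : T4Family → NE3Letters₁₁)
  (ne2 : (F : T4Family) → Stage13Params F N → (ℕ → ℝ) → List (ULoop F) → ℕ → NE2Objects₁₁)
  (ne1 : (F : T4Family) → Stage13Params F N → (ℕ → ℝ) → List (ULoop F) → NE1pCarriers)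

/-- **THE EDGE AT THE READING OF RECORD, CANONICAL HOME, ANALYTIC CURRENCY** (§3 at `readingOfRecord₁₃ w1 ℓ₃ ne2 ne1`, `hpin := rfl`; `ℓ₃ ∕ ne2 ∕ ne1` idle). [folklore] -/
theorem s_N22_readingOfRecord₁₃_of_s_N18_analytic
    (h18 : S_N18 (RRec₁₃ (readingOfRecord₁₃ w1 ℓ₃ ne2 ne1)))
    (hcoh : ∀ (F : T4Family) (θ : Stage13Params F N), θ.Provisos₁₃ F N → θ.Admissible F N →
      (∀ (k : ℕ) (X₁ : Node00.W1.Dom (F.P k) θ.τ9.M), (((w1 F θ).pairing k).pair X₁).1 = X₁.1 + 1) ∧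
      (∀ (k : ℕ) (X₁ : Node00.W1.Dom (F.P k) θ.τ9.M),
        (domSys (F.P (k + 1)) θ.τ9.M (((w1 F θ).pairing k).pair X₁).1).dj (((w1 F θ).pairing k).pair X₁).2 = (domSys (F.P k) θ.τ9.M X₁.1).dj X₁.2) ∧
      (∀ (k : ℕ) (X : Node00.W1.Dom (F.P (k + 1)) θ.τ9.M), 1 ≤ X.1 → ∃ X₁ : Node00.W1.Dom (F.P k) θ.τ9.M, ((w1 F θ).pairing k).pair X₁ = X) ∧
      (∀ (k : ℕ) (U : ((w1 F θ).pairing (k + 1)).BgA), ∃ U₁ : ((w1 F θ).pairing k).BgB, ((w1 F θ).pairing k).embB U₁ = ((w1 F θ).pairing (k + 1)).embA U) ∧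
      (∀ (k : ℕ) (g : ℕ → ℝ) (U : ((w1 F θ).pairing k).BgA) (X : Node00.W1.Dom (F.P k) θ.τ9.M), k < X.1 → ((w1 F θ).pairing k).EA ((w1 F θ).S k) g U X = 0))
    (hA : ∀ (F : T4Family) (θ : Stage13Params F N), θ.Provisos₁₃ F N → θ.Admissible F N → ∀ (k : ℕ),
      ∀ g ∈ Window θ.γ, ∀ (U : (((w1 F θ).u3Objects θ.γ).levelCarriers k).BgA) (X : (((w1 F θ).u3Objects θ.γ).levelCarriers k).Dom) (i : ℕ),
        i < (((w1 F θ).u3Objects θ.γ).levelCarriers k).scale X → ∃ (Fz : ℂ → ℂ) (Dset : Set ℂ), DifferentiableOn ℂ Fz Dset ∧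
          (∀ z ∈ Dset, ‖Fz z‖ ≤ (w1 F θ).li.A * (w1 F θ).li.μ ^ ((((w1 F θ).u3Objects θ.γ).levelCarriers k).scale X - 1 - i) *
            Real.exp (-(((w1 F θ).u3Objects θ.γ).κ * (((w1 F θ).u3Objects θ.γ).levelCarriers k).d X))) ∧
          (∀ t ∈ Ioc (0 : ℝ) θ.γ, closedBall (t : ℂ) (w1 F θ).li.r ⊆ Dset) ∧
          (∀ t ∈ Ioc (0 : ℝ) θ.γ, Fz t = (((w1 F θ).u3Objects θ.γ).EA k (Function.update g i t) U X : ℂ)))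
    (hnum : ∀ (F : T4Family) (θ : Stage13Params F N), θ.Provisos₁₃ F N → θ.Admissible F N →
      0 < (w1 F θ).li.C₀ ∧ 0 < (w1 F θ).li.θ₅ ∧ (w1 F θ).li.θ₅ < 1 ∧ 0 ≤ (w1 F θ).li.C₅ ∧
        2 * (w1 F θ).li.C₅ / (1 - (w1 F θ).li.θ₅) ≤ (w1 F θ).li.C₀ ∧ 0 < (w1 F θ).li.A ∧ (w1 F θ).li.θ₅ ≤ (w1 F θ).li.μ ∧
        (w1 F θ).li.C₀ ≤ 2 * (w1 F θ).li.A ∧ 0 < (w1 F θ).li.r ∧ 0 < (w1 F θ).li.s ∧ (w1 F θ).li.s < 1) :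
    S_N22 (RRec₁₃ (readingOfRecord₁₃ w1 ℓ₃ ne2 ne1)) :=
  s_N22_rRec₁₃_w1_of_s_N18_analytic _ w1 (fun _ _ _ _ _ => rfl) h18 hcoh hA hnum

/-- **THE EDGE AT THE READING OF RECORD, REGIME HOME, ANALYTIC CURRENCY** (any regime `Rg`; `Node00.unityNondeg₁₃ N` is rev 16's binder prefix). [folklore] -/
theorem s_N22_readingOfRecord₁₃On_of_s_N18_analytic (Rg : (F : T4Family) → Stage13Params F N → Prop)
    (h18 : S_N18 (RRec₁₃On (readingOfRecord₁₃ w1 ℓ₃ ne2 ne1) Rg))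
    (hcoh : ∀ (F : T4Family) (θ : Stage13Params F N), θ.Provisos₁₃ F N → Rg F θ → θ.Admissible F N →
      (∀ (k : ℕ) (X₁ : Node00.W1.Dom (F.P k) θ.τ9.M), (((w1 F θ).pairing k).pair X₁).1 = X₁.1 + 1) ∧
      (∀ (k : ℕ) (X₁ : Node00.W1.Dom (F.P k) θ.τ9.M),
        (domSys (F.P (k + 1)) θ.τ9.M (((w1 F θ).pairing k).pair X₁).1).dj (((w1 F θ).pairing k).pair X₁).2 = (domSys (F.P k) θ.τ9.M X₁.1).dj X₁.2) ∧
      (∀ (k : ℕ) (X : Node00.W1.Dom (F.P (k + 1)) θ.τ9.M), 1 ≤ X.1 → ∃ X₁ : Node00.W1.Dom (F.P k) θ.τ9.M, ((w1 F θ).pairing k).pair X₁ = X) ∧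
      (∀ (k : ℕ) (U : ((w1 F θ).pairing (k + 1)).BgA), ∃ U₁ : ((w1 F θ).pairing k).BgB, ((w1 F θ).pairing k).embB U₁ = ((w1 F θ).pairing (k + 1)).embA U) ∧
      (∀ (k : ℕ) (g : ℕ → ℝ) (U : ((w1 F θ).pairing k).BgA) (X : Node00.W1.Dom (F.P k) θ.τ9.M), k < X.1 → ((w1 F θ).pairing k).EA ((w1 F θ).S k) g U X = 0))
    (hA : ∀ (F : T4Family) (θ : Stage13Params F N), θ.Provisos₁₃ F N → Rg F θ → θ.Admissible F N → ∀ (k : ℕ),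
      ∀ g ∈ Window θ.γ, ∀ (U : (((w1 F θ).u3Objects θ.γ).levelCarriers k).BgA) (X : (((w1 F θ).u3Objects θ.γ).levelCarriers k).Dom) (i : ℕ),
        i < (((w1 F θ).u3Objects θ.γ).levelCarriers k).scale X → ∃ (Fz : ℂ → ℂ) (Dset : Set ℂ), DifferentiableOn ℂ Fz Dset ∧
          (∀ z ∈ Dset, ‖Fz z‖ ≤ (w1 F θ).li.A * (w1 F θ).li.μ ^ ((((w1 F θ).u3Objects θ.γ).levelCarriers k).scale X - 1 - i) *
            Real.exp (-(((w1 F θ).u3Objects θ.γ).κ * (((w1 F θ).u3Objects θ.γ).levelCarriers k).d X))) ∧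
          (∀ t ∈ Ioc (0 : ℝ) θ.γ, closedBall (t : ℂ) (w1 F θ).li.r ⊆ Dset) ∧
          (∀ t ∈ Ioc (0 : ℝ) θ.γ, Fz t = (((w1 F θ).u3Objects θ.γ).EA k (Function.update g i t) U X : ℂ)))
    (hnum : ∀ (F : T4Family) (θ : Stage13Params F N), θ.Provisos₁₃ F N → Rg F θ → θ.Admissible F N →
      0 < (w1 F θ).li.C₀ ∧ 0 < (w1 F θ).li.θ₅ ∧ (w1 F θ).li.θ₅ < 1 ∧ 0 ≤ (w1 F θ).li.C₅ ∧
        2 * (w1 F θ).li.C₅ / (1 - (w1 F θ).li.θ₅) ≤ (w1 F θ).li.C₀ ∧ 0 < (w1 F θ).li.A ∧ (w1 F θ).li.θ₅ ≤ (w1 F θ).li.μ ∧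
        (w1 F θ).li.C₀ ≤ 2 * (w1 F θ).li.A ∧ 0 < (w1 F θ).li.r ∧ 0 < (w1 F θ).li.s ∧ (w1 F θ).li.s < 1) :
    S_N22 (RRec₁₃On (readingOfRecord₁₃ w1 ℓ₃ ne2 ne1) Rg) :=
  s_N22_rRec₁₃On_w1_of_s_N18_analytic _ w1 Rg (fun _ _ _ _ _ => rfl) h18 hcoh hA hnum

open Classical in
/-- **THE EDGE AT THE READING OF RECORD, REGIME HOME, STRIP CURRENCY** (§1 at `readingOfRecord₁₃ w1 ℓ₃ ne2 ne1`, `hpin := rfl`). [folklore] -/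
theorem s_N22_readingOfRecord₁₃On_of_s_N18_stripBound (Rg : (F : T4Family) → Stage13Params F N → Prop)
    (h18 : S_N18 (RRec₁₃On (readingOfRecord₁₃ w1 ℓ₃ ne2 ne1) Rg))
    (hcoh : ∀ (F : T4Family) (θ : Stage13Params F N), θ.Provisos₁₃ F N → Rg F θ → θ.Admissible F N →
      (∀ (k : ℕ) (X₁ : Node00.W1.Dom (F.P k) θ.τ9.M), (((w1 F θ).pairing k).pair X₁).1 = X₁.1 + 1) ∧
      (∀ (k : ℕ) (X₁ : Node00.W1.Dom (F.P k) θ.τ9.M),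
        (domSys (F.P (k + 1)) θ.τ9.M (((w1 F θ).pairing k).pair X₁).1).dj (((w1 F θ).pairing k).pair X₁).2 = (domSys (F.P k) θ.τ9.M X₁.1).dj X₁.2) ∧
      (∀ (k : ℕ) (X : Node00.W1.Dom (F.P (k + 1)) θ.τ9.M), 1 ≤ X.1 → ∃ X₁ : Node00.W1.Dom (F.P k) θ.τ9.M, ((w1 F θ).pairing k).pair X₁ = X) ∧
      (∀ (k : ℕ) (U : ((w1 F θ).pairing (k + 1)).BgA), ∃ U₁ : ((w1 F θ).pairing k).BgB, ((w1 F θ).pairing k).embB U₁ = ((w1 F θ).pairing (k + 1)).embA U) ∧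
      (∀ (k : ℕ) (g : ℕ → ℝ) (U : ((w1 F θ).pairing k).BgA) (X : Node00.W1.Dom (F.P k) θ.τ9.M), k < X.1 → ((w1 F θ).pairing k).EA ((w1 F θ).S k) g U X = 0))
    (hnum : ∀ (F : T4Family) (θ : Stage13Params F N), θ.Provisos₁₃ F N → Rg F θ → θ.Admissible F N →
      0 < (w1 F θ).li.C₀ ∧ 0 < (w1 F θ).li.θ₅ ∧ (w1 F θ).li.θ₅ < 1 ∧ 0 ≤ (w1 F θ).li.C₅ ∧
        2 * (w1 F θ).li.C₅ / (1 - (w1 F θ).li.θ₅) ≤ (w1 F θ).li.C₀ ∧ 0 < (w1 F θ).li.A ∧ (w1 F θ).li.θ₅ ≤ (w1 F θ).li.μ ∧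
        (w1 F θ).li.C₀ ≤ 2 * (w1 F θ).li.A ∧ 0 < (w1 F θ).li.r ∧ 0 < (w1 F θ).li.s ∧ (w1 F θ).li.s < 1 ∧ 1 ≤ (w1 F θ).li.μ)
    (hstrip : ∀ (F : T4Family) (θ : Stage13Params F N), θ.Provisos₁₃ F N → Rg F θ → θ.Admissible F N → ∀ (k : ℕ),
      ∃ sp : (j : ℕ) → (domSys (F.P k) θ.τ9.M j).Dom → Set (CPair (F.P k) (MatA N)),
        (∀ (j : ℕ) (U : ((w1 F θ).pairing k).BgA) (Y : (domSys (F.P k) θ.τ9.M j).Dom), ((w1 F θ).pairing k).embA U ∈ sp j Y) ∧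
        (∀ (j : ℕ) (g : ℕ → ℝ), g ∈ Window θ.γ → ∀ (i : ℕ) (Y : (domSys (F.P k) θ.τ9.M j).Dom) (ψ : CPair (F.P k) (MatA N)), ψ ∈ sp j Y →
          ∃ (Ec : ℂ → ℂ) (O : Set ℂ), IsOpen O ∧ (∀ t ∈ Ioc (0 : ℝ) θ.γ, closedBall (t : ℂ) (w1 F θ).li.r ⊆ O) ∧ DifferentiableOn ℂ Ec O ∧
            (∀ z ∈ O, ‖Ec z‖ ≤ (w1 F θ).li.A * Real.exp (-((w1 F θ).li.κ * torusTreeLen Y.1))) ∧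
            (∀ t ∈ Ioc (0 : ℝ) θ.γ, Ec t = termC ((w1 F θ).S k) j Y (Function.update g i t) ψ))) :
    S_N22 (RRec₁₃On (readingOfRecord₁₃ w1 ℓ₃ ne2 ne1) Rg) :=
  s_N22_rRec₁₃On_w1_of_s_N18_stripBound _ w1 Rg (fun _ _ _ _ _ => rfl) h18 hcoh hnum hstrip

end ReadingOfRecord

end YMDAG.N22

end
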